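import Literature.AlgebraicGeometry.Surfaces.K3PeriodSurjectivityProofs
import Mathlib.NumberTheory.SumFourSquares

/-!
# Route MarkmanPartnerTransport · the rational K3 lattice `Λ_K3 ⊗ ℚ` admits a rational self-similitude of EVERY
# positive rational multiplier (fact-free); «similar K3 partners exist iff isometric ones do»

For every rational `m > 0` there is `G ∈ GL₂₂(ℚ)` with `ᵗG · Λ · G = m · Λ`, `Λ = k3Gram` the Gram matrix of the K3
lattice `E₈(−1)^{⊕2} ⊕ U^{⊕3}` (`exists_ratSimilitude_k3Gram`). Ingredients, all elementary and proved here: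
* `U(m) ≅ U` over `ℚ`: `G = diag(1, m)`;
* `E₈ ⊗ ℚ ≅ ⟨1⟩^{⊕8}`: Mathlib's Cartan matrix is `R · ᵗR` for the rational matrix `R` of Bourbaki's simple roots
  `α₁ = ½(ε₁ + ε₈ − ε₂ − ⋯ − ε₇)`, `α₂ = ε₁ + ε₂`, `α₃ = ε₂ − ε₁`, …, `α₈ = ε₇ − ε₆` (plate VII), with explicit
  inverse;
* `⟨m⟩^{⊕4} ≅ ⟨1⟩^{⊕4}` for `m > 0`: `m · d² = a² + b² + c² + e²` (Lagrange, Mathlib's `Nat.sum_four_squares`)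
  and the left-multiplication matrix of the quaternion `a + bi + cj + ek` (Euler's four-square identity), used
  twice on `ℚ⁸ = ℚ⁴ ⊕ ℚ⁴`.
Consequences recorded: the class of rational quadratic spaces that embed isometrically into `Λ_K3 ⊗ ℚ` is closed
under rescaling by positive rationals (`exists_isometricEmbedding_of_similarEmbedding`); a complex-linear,
rational, `k3Form`-similitude of `Λ_ℂ` of any positive rational multiplier (`exists_rational_k3Form_similitude`).

WHY (crux #4 `PicardThreeK3Squares` / support #2 / crux #5 of route MarkmanPartnerTransport; answers the g16
successor question "a PartnerExistence-type statement for SIMILAR (non-isometric) K3 partners"): the programme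
KS-MIXED (gen 16) transports HC⁴ between a `K3^{[2]}`-type fourfold `X` and `S ⊗ S` along a Hodge SIMILITUDE
`T(S)_ℚ → T(X)_ℚ` of any multiplier `μ` (necessarily `μ > 0` by the second Hodge–Riemann relation,
`KugaSatakeMixed.multiplier_pos_of_hom`). By the theorem here a similar partner never exists where an isometric
one does not: `T(X)_ℚ(μ⁻¹) ↪ Λ_ℚ` isometrically iff `T(X)_ℚ ↪ Λ_ℚ(μ) ≅ Λ_ℚ` isometrically — so, through the
surjectivity of the period map, `X` has a K3 partner with `T(S)_ℚ ≃ T(X)_ℚ(μ⁻¹)` iff it has one with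
`T(S')_ℚ ≃ T(X)_ℚ` (Hodge-isometric); the partnered class of item #9 / crux #5 (criterion "`NS(X)_ℚ` represents
`−2`", ROUTE-P1AI §D) is NOT enlarged by similar partners, and `K3`-orphans stay orphans. (On the `X` side the
analogous statement fails: `Λ_{K3^{[2]}} ⊗ ℚ = Λ_ℚ ⊕ ⟨−2⟩` has ODD rank `23`, so a self-similitude of multiplier
`m` forces `m²³ ∈ ℚ^{×2}`, i.e. `m` a square — not needed here.)

Pure lattice algebra; no named fact, no definition (explicit matrices enter through local notation), no sorry.
Prover seat hodge-nonav-19652-p1 (gen 17), `--supports stmt-HodgeConjecture-19652`. Nothing here proves HC.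

References: N. Bourbaki, *Groupes et algèbres de Lie*, Ch. VI, planche VII (`E₈`); J.-P. Serre, *A Course in
Arithmetic*, Ch. IV–V (rational quadratic forms; the four-square theorem via quaternions is Ch. IV App.);
D. Huybrechts, *Lectures on K3 Surfaces*, Ch. 14 §0–§1 (`Λ_K3`, `U`, `E₈`).
-/

noncomputable section

set_option linter.dupNamespace false

open Matrix
open Literature.AlgebraicGeometry.Surfaces

namespace Summit.HodgeConjecture.HodgeConjecture.Theorems.MarkmanPartnerTransport.LatticeSimilitude

/-! ### Generic bookkeeping: similitudes of Gram matrices -/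

section Generic

variable {ι κ : Type*} [Fintype ι] [Fintype κ] {K : Type*} [Field K]

/-- A similitude of a non-degenerate Gram matrix with non-zero multiplier is invertible:
`ᵗG M G = m M`, `det M ≠ 0`, `m ≠ 0` ⟹ `det G ≠ 0` (take determinants: `(det G)² · det M = m^n · det M`).
[folklore] -/
theorem det_ne_zero_of_similitude [DecidableEq ι] {G M : Matrix ι ι K} {m : K} (h : Gᵀ * M * G = m • M)
    (hM : M.det ≠ 0) (hm : m ≠ 0) : G.det ≠ 0 := by
  intro hG
  have := congrArg Matrix.det h
  rw [det_mul, det_mul, det_transpose, hG, det_smul] at this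
  simp only [zero_mul] at this
  exact (mul_ne_zero (pow_ne_zero _ hm) hM) this.symm

/-- Block-diagonal sum of two similitudes with the same multiplier. [folklore] -/
theorem fromBlocks_similitude {G₁ A : Matrix ι ι K} {G₂ D : Matrix κ κ K} {m : K}
    (h₁ : G₁ᵀ * A * G₁ = m • A) (h₂ : G₂ᵀ * D * G₂ = m • D) :
    (fromBlocks G₁ 0 0 G₂)ᵀ * fromBlocks A 0 0 D * fromBlocks G₁ 0 0 G₂ = m • fromBlocks A 0 0 D := by
  rw [fromBlocks_transpose, fromBlocks_multiply, fromBlocks_multiply, fromBlocks_smul]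
  simp [h₁, h₂]

/-- A similitude of `A` is a similitude of `−A`. [folklore] -/
theorem neg_similitude {G A : Matrix ι ι K} {m : K} (h : Gᵀ * A * G = m • A) :
    Gᵀ * (-A) * G = m • (-A) := by
  rw [Matrix.mul_neg, Matrix.neg_mul, h, smul_neg]

/-- Conjugating a "scalar Gram" similitude: if `ᵗX X = m · 1` and `A = ᵗV V` with `V⁻¹ V = 1 = V V⁻¹`... stated
with an explicit two-sided inverse `W` of `V`: `G = W X V` satisfies `ᵗG (ᵗV V) G = m · ᵗV V`. [folklore] -/
theorem similitude_of_transpose_mul_self [DecidableEq ι] {X V W : Matrix ι ι K} {m : K} (hX : Xᵀ * X = m • (1 : Matrix ι ι K))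
    (hWV : V * W = 1) :
    (W * X * V)ᵀ * (Vᵀ * V) * (W * X * V) = m • (Vᵀ * V) := by
  have hWVt : Wᵀ * Vᵀ = 1 := by rw [← transpose_mul, hWV, transpose_one]
  calc (W * X * V)ᵀ * (Vᵀ * V) * (W * X * V)
      = Vᵀ * Xᵀ * (Wᵀ * Vᵀ) * (V * W) * X * V := by
        simp only [transpose_mul, Matrix.mul_assoc]
    _ = Vᵀ * (Xᵀ * X) * V := by rw [hWVt, hWV]; simp only [Matrix.mul_one, Matrix.mul_assoc]
    _ = m • (Vᵀ * V) := by rw [hX]; simp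

end Generic

/-! ### The hyperbolic plane: `U(m) ≅ U` over `ℚ` -/

/-- `ᵗdiag(1, m) · U · diag(1, m) = m · U` for the hyperbolic plane `U = !![0,1;1,0]` (rationally: `U(m) ≅ U`
for every `m ≠ 0`). [folklore] -/
theorem hyperbolicPlane_similitude (m : ℚ) :
    (!![1, 0; 0, m] : Matrix (Fin 2) (Fin 2) ℚ)ᵀ * hyperbolicPlaneGram.map (Int.castRingHom ℚ) * !![1, 0; 0, m]
      = m • hyperbolicPlaneGram.map (Int.castRingHom ℚ) := by
  ext i j
  fin_cases i <;> fin_cases j <;>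
    simp [hyperbolicPlaneGram, Matrix.mul_apply, Fin.sum_univ_two, Matrix.transpose_apply]

/-! ### `E₈ ⊗ ℚ ≅ ⟨1⟩⁸`: Bourbaki's simple roots -/

/-- The matrix of Bourbaki's simple roots of `E₈` (plate VII) in the standard coordinates `ε₁, …, ε₈` of `ℚ⁸`:
rows `α₁ = ½(ε₁ + ε₈) − ½(ε₂ + ⋯ + ε₇)`, `α₂ = ε₁ + ε₂`, `α₃ = ε₂ − ε₁`, `α₄ = ε₃ − ε₂`, …, `α₈ = ε₇ − ε₆`.
Local notation (no definition is introduced). -/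
local notation3 "rootR" => (!![(1/2 : ℚ), -1/2, -1/2, -1/2, -1/2, -1/2, -1/2, 1/2;
     1, 1, 0, 0, 0, 0, 0, 0;
     -1, 1, 0, 0, 0, 0, 0, 0;
     0, -1, 1, 0, 0, 0, 0, 0;
     0, 0, -1, 1, 0, 0, 0, 0;
     0, 0, 0, -1, 1, 0, 0, 0;
     0, 0, 0, 0, -1, 1, 0, 0;
     0, 0, 0, 0, 0, -1, 1, 0] : Matrix (Fin 8) (Fin 8) ℚ)

/-- The inverse matrix of `rootR` (explicit). Local notation. -/
local notation3 "rootRinv" => (!![(0 : ℚ), 1/2, -1/2, 0, 0, 0, 0, 0;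
     0, 1/2, 1/2, 0, 0, 0, 0, 0;
     0, 1/2, 1/2, 1, 0, 0, 0, 0;
     0, 1/2, 1/2, 1, 1, 0, 0, 0;
     0, 1/2, 1/2, 1, 1, 1, 0, 0;
     0, 1/2, 1/2, 1, 1, 1, 1, 0;
     0, 1/2, 1/2, 1, 1, 1, 1, 1;
     2, 5/2, 7/2, 5, 4, 3, 2, 1] : Matrix (Fin 8) (Fin 8) ℚ)

/-- The rational `E₈` Cartan matrix. Local notation. -/
local notation3 "E8Q" => (Matrix.map CartanMatrix.E₈ (Int.castRingHom ℚ) : Matrix (Fin 8) (Fin 8) ℚ)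

/-- **`E₈ = ᵗ(ᵗR) (ᵗR)`, i.e. `R ᵗR = E₈`**: the Gram matrix of Bourbaki's simple roots in the standard Euclidean
form of `ℚ⁸` is Mathlib's Cartan matrix of `E₈` — so `E₈ ⊗ ℚ ≅ ⟨1⟩^{⊕8}` as rational quadratic spaces.
[folklore] -/
theorem rootR_transpose_transpose_mul : (rootR)ᵀᵀ * (rootR)ᵀ = E8Q := by
  rw [transpose_transpose]
  ext i j
  fin_cases i <;> fin_cases j <;>
    simp [Matrix.mul_apply, Fin.sum_univ_eight, CartanMatrix.E₈, Matrix.transpose_apply] <;> norm_num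

/-- `ᵗR · ᵗ(R⁻¹) = 1`. [folklore] -/
theorem rootR_transpose_mul_rootRinv_transpose : (rootR)ᵀ * (rootRinv)ᵀ = 1 := by
  rw [← transpose_mul, ← transpose_one]
  congr 1
  ext i j
  fin_cases i <;> fin_cases j <;>
    simp [Matrix.mul_apply, Fin.sum_univ_eight] <;> norm_num

/-! ### `⟨m⟩⁸ ≅ ⟨1⟩⁸` for `m > 0`: quaternions and Lagrange -/

/-- **Euler's four-square identity, twice**: for rationals `a b c d`, the block-diagonal matrix of two copies of
left multiplication by the quaternion `a + bi + cj + dk` satisfies `ᵗX X = (a² + b² + c² + d²) · 1₈`. [folklore] -/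
theorem quaternionBlock_transpose_mul_self (a b c d : ℚ) :
    (!![a, -b, -c, -d, 0, 0, 0, 0;
        b, a, -d, c, 0, 0, 0, 0;
        c, d, a, -b, 0, 0, 0, 0;
        d, -c, b, a, 0, 0, 0, 0;
        0, 0, 0, 0, a, -b, -c, -d;
        0, 0, 0, 0, b, a, -d, c;
        0, 0, 0, 0, c, d, a, -b;
        0, 0, 0, 0, d, -c, b, a] : Matrix (Fin 8) (Fin 8) ℚ)ᵀ *
      !![a, -b, -c, -d, 0, 0, 0, 0;
        b, a, -d, c, 0, 0, 0, 0;
        c, d, a, -b, 0, 0, 0, 0;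
        d, -c, b, a, 0, 0, 0, 0;
        0, 0, 0, 0, a, -b, -c, -d;
        0, 0, 0, 0, b, a, -d, c;
        0, 0, 0, 0, c, d, a, -b;
        0, 0, 0, 0, d, -c, b, a]
      = (a ^ 2 + b ^ 2 + c ^ 2 + d ^ 2) • (1 : Matrix (Fin 8) (Fin 8) ℚ) := by
  ext i j
  fin_cases i <;> fin_cases j <;>
    simp [Matrix.mul_apply, Fin.sum_univ_eight, Matrix.transpose_apply] <;> ring

/-- **`⟨m⟩^{⊕8} ≅ ⟨1⟩^{⊕8}` over `ℚ` for `m > 0`**: there is a rational `8 × 8` matrix `X` with `ᵗX X = m · 1`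
(Lagrange: `m · den² = num · den` is a sum of four squares; scale the quaternion block by `1/den`). [folklore] -/
theorem exists_transpose_mul_self_eq_smul_one (m : ℚ) (hm : 0 < m) :
    ∃ X : Matrix (Fin 8) (Fin 8) ℚ, Xᵀ * X = m • (1 : Matrix (Fin 8) (Fin 8) ℚ) := by
  -- `N = num · den` as a natural number, `m = N / den²`
  have hnum : 0 < m.num := Rat.num_pos.mpr hm
  obtain ⟨a, b, c, d, habcd⟩ := Nat.sum_four_squares (m.num.toNat * m.den)
  have hden : (m.den : ℚ) ≠ 0 := by exact_mod_cast m.den_ne_zero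
  have hN : ((a : ℚ) ^ 2 + (b : ℚ) ^ 2 + (c : ℚ) ^ 2 + (d : ℚ) ^ 2) = m * (m.den : ℚ) ^ 2 := by
    have h1 : ((a ^ 2 + b ^ 2 + c ^ 2 + d ^ 2 : ℕ) : ℚ) = ((m.num.toNat * m.den : ℕ) : ℚ) := by
      rw [habcd]
    push_cast at h1
    have h2 : ((m.num.toNat : ℕ) : ℚ) = (m.num : ℚ) := by
      rw [← Int.cast_natCast, Int.toNat_of_nonneg hnum.le]
    rw [h1, h2, ← Rat.mul_den_eq_num m]
    ring
  refine ⟨(1 / (m.den : ℚ)) • !![(a : ℚ), -b, -c, -d, 0, 0, 0, 0;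
        b, a, -d, c, 0, 0, 0, 0;
        c, d, a, -b, 0, 0, 0, 0;
        d, -c, b, a, 0, 0, 0, 0;
        0, 0, 0, 0, a, -b, -c, -d;
        0, 0, 0, 0, b, a, -d, c;
        0, 0, 0, 0, c, d, a, -b;
        0, 0, 0, 0, d, -c, b, a], ?_⟩
  rw [transpose_smul, Matrix.smul_mul, Matrix.mul_smul, quaternionBlock_transpose_mul_self, smul_smul,
    smul_smul, hN]
  congr 1
  field_simp

/-- **`E₈ ⊗ ℚ` is similar to itself with every positive rational multiplier**: `∃ G, ᵗG E₈ G = m E₈` (`m > 0`).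
[folklore] -/
theorem exists_similitude_E8 (m : ℚ) (hm : 0 < m) :
    ∃ G : Matrix (Fin 8) (Fin 8) ℚ, Gᵀ * E8Q * G = m • E8Q := by
  obtain ⟨X, hX⟩ := exists_transpose_mul_self_eq_smul_one m hm
  refine ⟨(rootRinv)ᵀ * X * (rootR)ᵀ, ?_⟩
  rw [← rootR_transpose_transpose_mul]
  exact similitude_of_transpose_mul_self hX rootR_transpose_mul_rootRinv_transpose

/-! ### The K3 lattice: `Λ_K3 ⊗ ℚ` is similar to itself with every positive rational multiplier -/

/-- The rational Gram matrix of the K3 lattice `Λ_K3 = E₈(−1)^{⊕2} ⊕ U^{⊕3}`. Local notation. -/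
local notation3 "ΛQ" => (Matrix.map k3Gram (Int.castRingHom ℚ) : Matrix K3Index K3Index ℚ)

/-- The rational hyperbolic plane. Local notation. -/
local notation3 "UQ" => (Matrix.map hyperbolicPlaneGram (Int.castRingHom ℚ) : Matrix (Fin 2) (Fin 2) ℚ)

/-- Block form of the rational K3 Gram matrix: `Λ_ℚ = (−E₈) ⊕ (−E₈) ⊕ U ⊕ U ⊕ U`. [cite: Huybrechts2016K3, Ch. 14 §1.1 (Λ = E₈(−1)^{⊕2} ⊕ U^{⊕3})] -/
theorem k3GramQ_eq_fromBlocks :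
    ΛQ = fromBlocks (fromBlocks (-E8Q) 0 0 (-E8Q)) 0 0 (fromBlocks UQ 0 0 (fromBlocks UQ 0 0 UQ)) := by
  simp only [k3Gram, fromBlocks_map, Matrix.map_zero, map_zero,
    Matrix.map_neg _ (map_neg (Int.castRingHom ℚ))]

/-- `det Λ_ℚ = −1` (from the tree's `k3Gram_det`). [cite: Huybrechts2016K3, Ch. 14 §1.1] -/
theorem k3GramQ_det : Matrix.det ΛQ = -1 := by
  have h := RingHom.map_det (Int.castRingHom ℚ) k3Gram
  rw [k3Gram_det, RingHom.mapMatrix_apply] at h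
  rw [← h]; simp

/-- **MAIN LATTICE THEOREM. `Λ_K3 ⊗ ℚ` admits a rational self-similitude of every positive rational multiplier**:
for every rational `m > 0` there is `G ∈ GL₂₂(ℚ)` with `ᵗG Λ G = m Λ`; equivalently the rational quadratic spaces
`Λ_ℚ` and `Λ_ℚ(m)` are isometric. (Block sum of `diag(1, m)` on each `U` and of
`ᵗ(R⁻¹) X ᵗR` on each `E₈(−1)`, `ᵗX X = m · 1₈` from quaternions and Lagrange.) [folklore] -/
theorem exists_ratSimilitude_k3Gram (m : ℚ) (hm : 0 < m) :
    ∃ G : Matrix K3Index K3Index ℚ, G.det ≠ 0 ∧ Gᵀ * ΛQ * G = m • ΛQ := by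
  obtain ⟨G₈, h₈⟩ := exists_similitude_E8 m hm
  have hU := hyperbolicPlane_similitude m
  have key : (fromBlocks (fromBlocks G₈ 0 0 G₈) 0 0
      (fromBlocks !![1, 0; 0, m] 0 0 (fromBlocks !![1, 0; 0, m] 0 0 !![1, 0; 0, m])))ᵀ * ΛQ *
      fromBlocks (fromBlocks G₈ 0 0 G₈) 0 0
        (fromBlocks !![1, 0; 0, m] 0 0 (fromBlocks !![1, 0; 0, m] 0 0 !![1, 0; 0, m])) = m • ΛQ := by
    rw [k3GramQ_eq_fromBlocks]
    exact fromBlocks_similitude (fromBlocks_similitude (neg_similitude h₈) (neg_similitude h₈))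
      (fromBlocks_similitude hU (fromBlocks_similitude hU hU))
  exact ⟨_, det_ne_zero_of_similitude key (by rw [k3GramQ_det]; norm_num) hm.ne', key⟩

/-! ### Consequences -/

/-- Transport of the form along a similitude, vector form: `ᵗG Λ G = m Λ` gives
`(G x) · Λ (G y) = m · (x · Λ y)`. [folklore] -/
theorem dotProduct_mulVec_of_similitude {G : Matrix K3Index K3Index ℚ} {m : ℚ} (h : Gᵀ * ΛQ * G = m • ΛQ)
    (x y : K3Index → ℚ) : (G *ᵥ x) ⬝ᵥ (ΛQ *ᵥ (G *ᵥ y)) = m * (x ⬝ᵥ (ΛQ *ᵥ y)) := by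
  rw [mulVec_mulVec, ← vecMul_transpose, ← dotProduct_mulVec, mulVec_mulVec, ← Matrix.mul_assoc, h,
    smul_mulVec, dotProduct_smul, smul_eq_mul]

/-- **The class of rational quadratic spaces that embed isometrically into `Λ_K3 ⊗ ℚ` is closed under rescaling by
positive rationals**: if `(V, μ · B)` embeds isometrically into `Λ_ℚ` (`μ > 0`), so does `(V, B)`. Applied to
`V = T(X)_ℚ` (a `K3^{[2]}`-type fourfold `X`) with its Beauville–Bogomolov form: a Hodge-similar K3-lattice
embedding of multiplier `μ` (the lattice datum of a "similar K3 partner", KS-MIXED gen 16) exists iff a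
Hodge-ISOMETRIC one does (the datum of item #9 `PartnerExistence`) — the similitude `G` is rational, so it
respects every rational sub-structure imposed on the image (periods are carried along by `G ⊗ ℂ`). [folklore] -/
theorem exists_isometricEmbedding_of_similarEmbedding {V : Type*} [AddCommGroup V] [Module ℚ V]
    (B : LinearMap.BilinForm ℚ V) {μ : ℚ} (hμ : 0 < μ) (f : V →ₗ[ℚ] (K3Index → ℚ))
    (hf : Function.Injective f) (hsim : ∀ v w, f v ⬝ᵥ (ΛQ *ᵥ f w) = μ * B v w) :
    ∃ f' : V →ₗ[ℚ] (K3Index → ℚ), Function.Injective f' ∧ ∀ v w, f' v ⬝ᵥ (ΛQ *ᵥ f' w) = B v w := by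
  obtain ⟨G, hGdet, hG⟩ := exists_ratSimilitude_k3Gram μ⁻¹ (inv_pos.mpr hμ)
  refine ⟨G.mulVecLin ∘ₗ f, ?_, fun v w => ?_⟩
  · have hGu : IsUnit G := (Matrix.isUnit_iff_isUnit_det G).mpr (isUnit_iff_ne_zero.mpr hGdet)
    exact (Matrix.mulVec_injective_iff_isUnit.mpr hGu).comp hf
  · simp only [LinearMap.coe_comp, Function.comp_apply, Matrix.mulVecLin_apply]
    rw [dotProduct_mulVec_of_similitude hG, hsim, ← mul_assoc, inv_mul_cancel₀ hμ.ne', one_mul]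

/-- Conversely (trivially, with `G` of multiplier `μ`): an isometric embedding of `(V, B)` gives one of
`(V, μ · B)` for every `μ > 0`; recorded for symmetry. [folklore] -/
theorem exists_similarEmbedding_of_isometricEmbedding {V : Type*} [AddCommGroup V] [Module ℚ V]
    (B : LinearMap.BilinForm ℚ V) {μ : ℚ} (hμ : 0 < μ) (f : V →ₗ[ℚ] (K3Index → ℚ))
    (hf : Function.Injective f) (hiso : ∀ v w, f v ⬝ᵥ (ΛQ *ᵥ f w) = B v w) :
    ∃ f' : V →ₗ[ℚ] (K3Index → ℚ), Function.Injective f' ∧ ∀ v w, f' v ⬝ᵥ (ΛQ *ᵥ f' w) = μ * B v w := by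
  obtain ⟨G, hGdet, hG⟩ := exists_ratSimilitude_k3Gram μ hμ
  refine ⟨G.mulVecLin ∘ₗ f, ?_, fun v w => ?_⟩
  · have hGu : IsUnit G := (Matrix.isUnit_iff_isUnit_det G).mpr (isUnit_iff_ne_zero.mpr hGdet)
    exact (Matrix.mulVec_injective_iff_isUnit.mpr hGu).comp hf
  · simp only [LinearMap.coe_comp, Function.comp_apply, Matrix.mulVecLin_apply]
    rw [dotProduct_mulVec_of_similitude hG, hiso]

/-! ### Complex form: a rational `k3Form`-similitude of `Λ_ℂ = (K3Index → ℂ)` of any positive rational multiplier -/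

/-- The complexified K3 Gram matrix. Local notation. -/
local notation3 "ΛC" => (Matrix.map k3Gram (Int.castRingHom ℂ) : Matrix K3Index K3Index ℂ)

/-- The tree's `k3Form` is the bilinear form of the complexified Gram matrix: `(a.b) = a · Λ_ℂ b`. [folklore] -/
theorem k3Form_eq_dotProduct_mulVec (a b : K3Index → ℂ) : k3Form a b = a ⬝ᵥ (ΛC *ᵥ b) := by
  simp only [k3Form, dotProduct, Matrix.mulVec, Matrix.map_apply, eq_intCast, Finset.mul_sum, mul_assoc]

/-- Complexification of a rational similitude of `Λ_ℚ` is a similitude of `Λ_ℂ` (same multiplier). [folklore] -/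
theorem map_similitude {G : Matrix K3Index K3Index ℚ} {m : ℚ} (h : Gᵀ * ΛQ * G = m • ΛQ) :
    (G.map (algebraMap ℚ ℂ))ᵀ * ΛC * G.map (algebraMap ℚ ℂ) = (m : ℂ) • ΛC := by
  have hΛ : (Matrix.map k3Gram (Int.castRingHom ℚ)).map (algebraMap ℚ ℂ) = ΛC := by
    ext i j; simp [Matrix.map_apply]
  have this : (Gᵀ * Matrix.map k3Gram (Int.castRingHom ℚ) * G).map (algebraMap ℚ ℂ) =
      (m • Matrix.map k3Gram (Int.castRingHom ℚ)).map (algebraMap ℚ ℂ) := by rw [h]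
  rw [← (algebraMap ℚ ℂ).mapMatrix_apply, map_mul, map_mul] at this
  simp only [RingHom.mapMatrix_apply, Matrix.transpose_map] at this
  rw [hΛ] at this
  rw [this, Matrix.map_smul _ _ (fun a => by rw [smul_eq_mul, map_mul]; rfl), hΛ]
  ext i j
  simp [Matrix.smul_apply, Algebra.smul_def]

/-- **A rational, complex-linear `k3Form`-similitude of `Λ_ℂ` of every positive rational multiplier**: for
`m ∈ ℚ_{>0}` there is a `ℂ`-linear automorphism `g` of `Λ_ℂ = (K3Index → ℂ)` mapping rational vectors to rational
vectors (in both directions) with `(g a . g b) = m (a . b)` for the tree's `k3Form` — the form in which the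
lane's marked statements (`Huybrechts_K3_periodSurjective_projective`, the partner clauses (g1)–(g7)) would
consume the lattice theorem. [folklore] -/
theorem exists_rational_k3Form_similitude (m : ℚ) (hm : 0 < m) :
    ∃ g : (K3Index → ℂ) ≃ₗ[ℂ] (K3Index → ℂ),
      (∀ v : K3Index → ℚ, ∃ w : K3Index → ℚ, g (fun i => (v i : ℂ)) = fun i => (w i : ℂ)) ∧
      (∀ w : K3Index → ℚ, ∃ v : K3Index → ℚ, g (fun i => (v i : ℂ)) = fun i => (w i : ℂ)) ∧
      ∀ a b : K3Index → ℂ, k3Form (g a) (g b) = (m : ℂ) * k3Form a b := by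
  obtain ⟨G, hGdet, hG⟩ := exists_ratSimilitude_k3Gram m hm
  set GC : Matrix K3Index K3Index ℂ := G.map (algebraMap ℚ ℂ) with hGC
  have hdetC : GC.det ≠ 0 := by
    rw [hGC, ← RingHom.mapMatrix_apply, ← RingHom.map_det]
    exact (map_ne_zero _).mpr hGdet
  haveI : Invertible GC.det := invertibleOfNonzero hdetC
  have hInv : Invertible GC := GC.invertibleOfDetInvertible
  have hGu : IsUnit G := (Matrix.isUnit_iff_isUnit_det G).mpr (isUnit_iff_ne_zero.mpr hGdet)
  refine ⟨GC.toLinearEquiv' hInv, fun v => ?_, fun w => ?_, fun a b => ?_⟩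
  · refine ⟨G *ᵥ v, ?_⟩
    change Matrix.toLin' GC _ = _
    rw [Matrix.toLin'_apply, hGC]
    ext i
    simp [Matrix.mulVec, dotProduct, Matrix.map_apply]
  · -- surjectivity on rational vectors: `G` is invertible over `ℚ`
    obtain ⟨v, hv⟩ := (Matrix.mulVec_surjective_iff_isUnit.mpr hGu) w
    refine ⟨v, ?_⟩
    change Matrix.toLin' GC _ = _
    rw [Matrix.toLin'_apply, hGC, ← hv]
    ext i
    simp [Matrix.mulVec, dotProduct, Matrix.map_apply]
  · change k3Form (Matrix.toLin' GC a) (Matrix.toLin' GC b) = _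
    rw [Matrix.toLin'_apply, Matrix.toLin'_apply, k3Form_eq_dotProduct_mulVec, k3Form_eq_dotProduct_mulVec,
      mulVec_mulVec, ← vecMul_transpose, ← dotProduct_mulVec, mulVec_mulVec, ← Matrix.mul_assoc,
      map_similitude hG, smul_mulVec, dotProduct_smul, smul_eq_mul]

end Summit.HodgeConjecture.HodgeConjecture.Theorems.MarkmanPartnerTransport.LatticeSimilitude

end
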